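import Literature.MathematicalPhysics.QuantumFieldTheory.OSDistributionSpaceGapContinuation
import HarnessLib

/-!
# The damped Cauchy–Schwarz bound for matrix elements of the OS holomorphic semigroup

Osterwalder–Schrader II (Comm. Math. Phys. 42 (1975)), Ch. VI.1, p. 298: "Then `(Ψ₁, e^{-zH} Ψ₂)`
defines an analytic continuation of `T_k(ξ)` in one variable …, whose absolute value is bounded by
`‖Ψ₁‖ ‖Ψ₂‖`." For bounds that must be *uniform in a time regularisation* (Ch. VI.1; see
`OSSemigroupAveraging`) one needs the sharper, **damped** form of this Cauchy–Schwarz bound: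
splitting `e^{-τH} = e^{-(τ/2)H} e^{-(τ/2)H}` and moving one factor to the other side,

  `|⟪v, e^{-τH} w⟫| ≤ ‖e^{-(Re τ/2)H} v‖ ‖e^{-(Re τ/2)H} w‖`   (`Re τ ≥ 0`),

because `‖e^{-(τ/2)H} w‖ = ‖e^{-(Re τ/2)H} w‖` (the imaginary part acts unitarily). Combined with the
monotonicity bound `‖e^{-LH} v(G)‖ ≤ ‖v(G^ρ)‖` of `OSSemigroupAveraging` this bounds the continued
Schwinger functions across a gap by OS pairings of *time-averaged* test functions. Everything is
proved from the tree's holomorphic semigroup (`holoShiftH`: `holoShiftH_add`,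
`inner_holoShiftH_left`, `norm_holoShiftH_apply_sq`).

## References

* K. Osterwalder, R. Schrader, *Axioms for Euclidean Green's functions II*, Comm. Math. Phys.
  42 (1975) 281–305, Ch. VI.1 p. 298. [OsterwalderSchraderCMP1975]
* K. Osterwalder, R. Schrader, *Axioms for Euclidean Green's functions*, Comm. Math. Phys. 31
  (1973), §4.1 p. 92. [OsterwalderSchraderCMP1973]
-/

noncomputable section

open MeasureTheory Set Filter
open _root_.Topology
open scoped InnerProductSpace NNReal ComplexConjugate

namespace Literature.MathematicalPhysics.QuantumFieldTheory

variable {d : ℕ} [NeZero d]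

open Literature.MathematicalPhysics.QuantumLattice (SchwingerFamily)
open Literature.MathematicalPhysics.QuantumLattice.SchwingerFamily
open Literature.MathematicalPhysics.QuantumLattice.SchwingerFamily.OSSpace

variable {𝔖 : SchwingerFamily (EuclideanSpace ℝ (Fin d))} (hE1 : 𝔖.IsEuclideanCovariant)
  {hE2 : 𝔖.IsOSReflectionPositive}

/-- **The norm of `e^{-τH} w` only sees `Re τ`**: `‖e^{-τH} w‖ = ‖e^{-(Re τ)H} w‖` for `Re τ ≥ 0`
(both squares are `Re ⟪w, e^{-2(Re τ)H} w⟫`). [folklore] -/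
theorem norm_holoShiftH_apply_eq_re {τ : ℂ} (hτ : 0 ≤ τ.re) (w : OSHilbert 𝔖 hE2) :
    ‖holoShiftH (hE2 := hE2) hE1 τ w‖ = ‖holoShiftH (hE2 := hE2) hE1 (τ.re : ℂ) w‖ := by
  have h1 := norm_holoShiftH_apply_sq (hE2 := hE2) hE1 hτ w
  have h2 := norm_holoShiftH_apply_sq (hE2 := hE2) hE1 (show 0 ≤ ((τ.re : ℂ)).re by simpa using hτ) w
  simp only [Complex.ofReal_re] at h2
  rw [← h2] at h1
  exact le_antisymm (le_of_pow_le_pow_left₀ two_ne_zero (norm_nonneg _) h1.le)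
    (le_of_pow_le_pow_left₀ two_ne_zero (norm_nonneg _) h1.ge)

/-- **The damped Cauchy–Schwarz bound**: for `Re τ ≥ 0`,
`|⟪v, e^{-τH} w⟫| ≤ ‖e^{-(Re τ/2)H} v‖ ‖e^{-(Re τ/2)H} w‖`. [cite: OsterwalderSchraderCMP1975, Ch. VI.1 p. 298] -/
theorem norm_inner_holoShiftH_le_damped {τ : ℂ} (hτ : 0 ≤ τ.re) (v w : OSHilbert 𝔖 hE2) :
    ‖⟪v, holoShiftH (hE2 := hE2) hE1 τ w⟫_ℂ‖ ≤
      ‖holoShiftH (hE2 := hE2) hE1 ((τ.re / 2 : ℝ) : ℂ) v‖ * ‖holoShiftH (hE2 := hE2) hE1 ((τ.re / 2 : ℝ) : ℂ) w‖ := by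
  have hh : 0 ≤ (τ / 2).re := by simp; linarith
  have hhc : 0 ≤ (conj (τ / 2)).re := by rw [Complex.conj_re]; exact hh
  -- split and move one factor across
  have hsplit : holoShiftH (hE2 := hE2) hE1 τ w = holoShiftH hE1 (τ / 2) (holoShiftH hE1 (τ / 2) w) := by
    rw [← mul_apply_eq_comp, ← holoShiftH_add hE1 hh hh, add_halves]
  have hmove : ⟪v, holoShiftH (hE2 := hE2) hE1 (τ / 2) (holoShiftH hE1 (τ / 2) w)⟫_ℂ =
      ⟪holoShiftH (hE2 := hE2) hE1 (conj (τ / 2)) v, holoShiftH hE1 (τ / 2) w⟫_ℂ := by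
    rw [inner_holoShiftH_left hE1 hhc, Complex.conj_conj]
  rw [hsplit, hmove]
  refine (norm_inner_le_norm _ _).trans ?_
  rw [norm_holoShiftH_apply_eq_re hE1 hhc, norm_holoShiftH_apply_eq_re hE1 hh]
  have h1 : ((conj (τ / 2)).re : ℂ) = ((τ.re / 2 : ℝ) : ℂ) := by
    rw [Complex.conj_re]; simp
  have h2 : (((τ / 2).re : ℝ) : ℂ) = ((τ.re / 2 : ℝ) : ℂ) := by simp
  rw [h1, h2]

/-- **The damped bound for the continued Schwinger functions across a gap**:
`|gapContinuation p q τ| ≤ ‖e^{-(Re τ/2)H} v(F_p)‖ ‖e^{-(Re τ/2)H} v(F_q)‖` for `Re τ ≥ 0` — the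
bound to be combined with `norm_shiftH_δ_le_norm_δ_average` (`OSSemigroupAveraging`). [cite: OsterwalderSchraderCMP1975, Ch. VI.1 p. 298] -/
theorem norm_gapContinuation_le_damped (hE2 : 𝔖.IsOSReflectionPositive) (p q : PosGen d) {τ : ℂ} (hτ : 0 ≤ τ.re) :
    ‖gapContinuation 𝔖 hE1 hE2 p q τ‖ ≤
      ‖holoShiftH (hE2 := hE2) hE1 ((τ.re / 2 : ℝ) : ℂ) (ι 𝔖 hE2 (δ 𝔖 hE2 p))‖ *
        ‖holoShiftH (hE2 := hE2) hE1 ((τ.re / 2 : ℝ) : ℂ) (ι 𝔖 hE2 (δ 𝔖 hE2 q))‖ :=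
  norm_inner_holoShiftH_le_damped hE1 hτ _ _

/-- The damped bound with the real semigroup `shiftH` (`e^{-sH} = holoShiftH s` for `s > 0`):
for `Re τ > 0`, `|gapContinuation p q τ| ≤ ‖e^{-(Re τ/2)H} v(F_p)‖ ‖e^{-(Re τ/2)H} v(F_q)‖`. [folklore] -/
theorem norm_gapContinuation_le_shiftH (hE2 : 𝔖.IsOSReflectionPositive) (p q : PosGen d) {τ : ℂ} (hτ : 0 < τ.re) :
    ‖gapContinuation 𝔖 hE1 hE2 p q τ‖ ≤
      ‖shiftH hE2 (τ.re / 2) (ι 𝔖 hE2 (δ 𝔖 hE2 p))‖ * ‖shiftH hE2 (τ.re / 2) (ι 𝔖 hE2 (δ 𝔖 hE2 q))‖ := by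
  have h := norm_gapContinuation_le_damped hE1 hE2 p q hτ.le
  rwa [holoShiftH_ofReal hE1 (by positivity : 0 < τ.re / 2)] at h

end Literature.MathematicalPhysics.QuantumFieldTheory
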